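import Mathlib
import Summits.Ventures.LatticeQCDFlow.Scaling.GroupSlabCost
import Summits.Ventures.LatticeQCDFlow.Scaling.TorusSlabCost
import Summits.Ventures.LatticeQCDFlow.Scaling.SlabKernel

/-!
# LatticeQCDFlow / Scaling — the torus as a slab chain for a GENERAL gauge group: the bond
# dictionary, its law, and the plaquette sum `Σ_q Re tr ρ(U_q)` as a slab-chain cost

HONEST FRAMING: exact (Metropolis-corrected) sampling algorithms for lattice gauge theory;
figures of merit are autocorrelation/cost numbers at stated couplings and volumes; no
continuum-physics claim.

Venture `LatticeQCDFlow` (cell pub-lqcd), topic `Scaling`, FANOUT row 30 (lean-1) — OUR WORK, file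
7 of the extension of the slab-chain proof of (LC)/(U′) to a general compact gauge group `G` with a
matrix representation `ρ`.  The `U(1)` dictionary is `Scaling/TorusHeightDecomposition.lean` +
`Scaling/TorusSlabCost.lean`; this file repeats it for bond variables `W : GaugeConfig d (n+1) G` in
ANY group (the index combinatorics `toZ`, `toF`, `edgeEquiv`, `siteEquivLayer/Slab`, `LSite`,
`LEdge` are reused verbatim), heights read along the axis `a` with the sign reversed:
* `layerCfgG`, `vertCfgG`, `heightCfgG` — layer / vertical variables of a configuration;
  **`measurePreserving_heightCfgG`** — the Haar product on the bonds is read as the product law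
  required by the slab chain;
* `plaquetteHolonomy_horizontalG`, `plaquetteHolonomy_lateralG`, `plaquetteHolonomy_lateralG_rev` —
  torus plaquette holonomies in slab coordinates (a lateral plaquette of slab `h` is `plaqG` of
  `Scaling/GroupSlabCost.lean`, the reversed label its inverse);
* `hplaqG`, `layerCostG`, **`gChain ρ d n a`** — the slab chain of the representation `ρ`
  (`a_h = layerCostG ρ`, `s_h = slabCostG ρ`); **`sum_plaquetteTrRe_eq_cost`** — for `ρ` with
  `Re tr ρ(g⁻¹) = Re tr ρ(g)`: `Σ_{genuine q} Re tr ρ(U_q(W)) = (gChain ρ).cost (heightCfgG W)`;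
* `plaquetteHolonomy_axisSite_eq` — the plaquette `(i, j)` based at `−t·e_a` is the layer
  plaquette of the layer at height `t`: `e(ℓ₀) e(ℓ₁) e(ℓ₂)⁻¹ e(ℓ₃)⁻¹`, `e = layerCfgG W t`, `ℓ_k =
  pedge k` (`Scaling/U1PlaquetteLayer.lean`).
Elementary; nothing is cited as a fact; `def`s `layerCfgG`, `vertCfgG`, `heightCfgG`, `hplaqG`,
`layerCostG`, `gChain`; no `sorry`.
-/

noncomputable section

open MeasureTheory Filter Finset
open Literature.MathematicalPhysics.QuantumFieldTheory
open Summit.Ventures.LatticeQCDFlow.Theory2.Lattice.U1Layer (LSite LEdge zsite usite pedge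
  baseSite edgeEquiv siteEquivLayer siteEquivSlab update_shift_of_ne update_shift_self
  measurePreserving_reindex ite_lt_split sum_LEdge_eq_sum_dite)

namespace Summit.Ventures.LatticeQCDFlow.Theory2.GroupLayer

variable {G : Type*} [Group G] {d n : ℕ} {a : Fin d} {N : ℕ} (ρ : G →* Matrix (Fin N) (Fin N) ℂ)

/-! ## 1. The configuration read by heights, and its law -/

/-- The horizontal bond variables of the layer at height `h`. [folklore] -/
def layerCfgG (a : Fin d) (W : GaugeConfig d (n + 1) G) (h : Fin (n + 1)) :
    LEdge d (n + 1) a → G :=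
  fun ℓ => W (Function.update ℓ.src.1 a (-(Lattice.U1Layer.toZ h)), ℓ.dir)

/-- The vertical bond variables of the slab `h`. [folklore] -/
def vertCfgG (a : Fin d) (W : GaugeConfig d (n + 1) G) (h : Fin (n + 1)) :
    LSite d (n + 1) a → G :=
  fun y => W (Function.update y.1 a (-(Lattice.U1Layer.toZ h) - 1), a)

/-- **The configuration read by heights**: layers and vertical variables. [folklore] -/
def heightCfgG (a : Fin d) (W : GaugeConfig d (n + 1) G) :
    (Fin (n + 1) → LEdge d (n + 1) a → G) × (Fin (n + 1) → LSite d (n + 1) a → G) :=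
  (layerCfgG a W, vertCfgG a W)

/-- **The law of the configuration read by heights** is the product of Haar products required by
the slab chain (any compact `G`). [folklore] -/
theorem measurePreserving_heightCfgG [TopologicalSpace G] [IsTopologicalGroup G] [CompactSpace G]
    [MeasurableSpace G] [BorelSpace G] (a : Fin d) :
    MeasurePreserving (heightCfgG (n := n) a) (Measure.pi fun _ : Edge d (n + 1) => haarProbability G)
      ((Measure.pi fun _ : Fin (n + 1) =>
          Measure.pi fun _ : LEdge d (n + 1) a => haarProbability G).prod
        (Measure.pi fun _ : Fin (n + 1) =>
          Measure.pi fun _ : LSite d (n + 1) a => haarProbability G)) := by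
  have h1 := measurePreserving_reindex (haarProbability G) (edgeEquiv (n := n) a)
  have h2 := measurePreserving_sumPiEquivProdPi (fun _ : (Fin (n + 1) × LEdge d (n + 1) a) ⊕
    (Fin (n + 1) × LSite d (n + 1) a) => haarProbability G)
  -- currying a finite product of probability measures preserves it (`Measure.infinitePi_map_curry`)
  have hc : ∀ (κ : Type) [Fintype κ], MeasurePreserving (MeasurableEquiv.curry (Fin (n + 1)) κ G)
      (Measure.pi fun _ : Fin (n + 1) × κ => haarProbability G)
      (Measure.pi fun _ : Fin (n + 1) => Measure.pi fun _ : κ => haarProbability G) := by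
    intro κ _
    refine ⟨(MeasurableEquiv.curry (Fin (n + 1)) κ G).measurable, ?_⟩
    have h := Measure.infinitePi_map_curry (fun (_ : Fin (n + 1)) (_ : κ) => haarProbability G)
    simp only [Measure.infinitePi_eq_pi] at h
    exact h
  have h3 := (hc (LEdge d (n + 1) a)).prod (hc (LSite d (n + 1) a))
  have h := h3.comp (h2.comp h1)
  have hfun : heightCfgG (n := n) a =
      (Prod.map (MeasurableEquiv.curry (Fin (n + 1)) (LEdge d (n + 1) a) G)
        (MeasurableEquiv.curry (Fin (n + 1)) (LSite d (n + 1) a) G)) ∘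
      ((MeasurableEquiv.sumPiEquivProdPi fun _ : (Fin (n + 1) × LEdge d (n + 1) a) ⊕
          (Fin (n + 1) × LSite d (n + 1) a) => G) ∘
        fun (W : Edge d (n + 1) → G) b => W ((edgeEquiv a).symm b)) := by
    funext W
    rfl
  rw [hfun]
  exact h

/-! ## 2. Plaquette holonomies in slab coordinates -/

omit [Group G] in
/-- The layer variable at the target of a layer edge. [folklore] -/
theorem layerCfgG_tgt (W : GaugeConfig d (n + 1) G) (h : Fin (n + 1)) (y : LSite d (n + 1) a)
    {k l : Fin d} (hk : k ≠ a) (hl : l ≠ a) :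
    layerCfgG a W h ⟨(LEdge.tgt ⟨(y, k), hk⟩, l), hl⟩ =
      W (Site.shift (Function.update y.1 a (-(Lattice.U1Layer.toZ h))) k, l) := by
  simp only [layerCfgG, LEdge.src, LEdge.dir, LEdge.tgt, update_shift_of_ne _ _ hk]

/-- **A horizontal plaquette read in layer coordinates** (`k, l ≠ a`, site `x = update y a (−h)`):
`U_{(x;k,l)}(W) = e(y,k) e(y+e_k,l) e(y+e_l,k)⁻¹ e(y,l)⁻¹` with `e = layerCfgG h`. [folklore] -/
theorem plaquetteHolonomy_horizontalG (W : GaugeConfig d (n + 1) G) (h : Fin (n + 1))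
    (y : LSite d (n + 1) a) {k l : Fin d} (hk : k ≠ a) (hl : l ≠ a) :
    plaquetteHolonomy W (Function.update y.1 a (-(Lattice.U1Layer.toZ h))) k l =
      layerCfgG a W h ⟨(y, k), hk⟩ * layerCfgG a W h ⟨(LEdge.tgt ⟨(y, k), hk⟩, l), hl⟩ *
        (layerCfgG a W h ⟨(LEdge.tgt ⟨(y, l), hl⟩, k), hk⟩)⁻¹ * (layerCfgG a W h ⟨(y, l), hl⟩)⁻¹ := by
  rw [layerCfgG_tgt W h y hk hl, layerCfgG_tgt W h y hl hk]
  simp only [plaquetteHolonomy, layerCfgG, LEdge.src, LEdge.dir]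

/-- **A lateral plaquette read in slab coordinates** (`b ≠ a`, site `x = update y a (−h−1)`):
`U_{(x;a,b)}(W) = plaqG (layerCfgG h) (vertCfgG h) (layerCfgG (h+1)) (y, b)`. [folklore] -/
theorem plaquetteHolonomy_lateralG (W : GaugeConfig d (n + 1) G) (h : Fin (n + 1))
    (y : LSite d (n + 1) a) {b : Fin d} (hb : b ≠ a) :
    plaquetteHolonomy W (Function.update y.1 a (-(Lattice.U1Layer.toZ h) - 1)) a b =
      plaqG (layerCfgG a W h) (vertCfgG a W h) (layerCfgG a W (h + 1)) ⟨(y, b), hb⟩ := by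
  simp only [plaquetteHolonomy, plaqG, layerCfgG, vertCfgG, LEdge.src, LEdge.dir, LEdge.tgt,
    update_shift_self, update_shift_of_ne _ _ hb, Lattice.U1Layer.toZ_add_one, neg_add, sub_add_cancel,
    ← sub_eq_add_neg]

/-- The reversed lateral label `(x; b, a)` (`b < a`) has the inverse holonomy. [folklore] -/
theorem plaquetteHolonomy_lateralG_rev (W : GaugeConfig d (n + 1) G) (h : Fin (n + 1))
    (y : LSite d (n + 1) a) {b : Fin d} (hb : b ≠ a) :
    plaquetteHolonomy W (Function.update y.1 a (-(Lattice.U1Layer.toZ h) - 1)) b a =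
      (plaqG (layerCfgG a W h) (vertCfgG a W h) (layerCfgG a W (h + 1)) ⟨(y, b), hb⟩)⁻¹ := by
  rw [← plaquetteHolonomy_lateralG W h y hb]
  simp only [plaquetteHolonomy, mul_inv_rev, inv_inv, mul_assoc]

/-! ## 3. The slab chain of the representation and the plaquette sum -/

/-- The holonomy of the horizontal plaquette `(y; k, l)` of a layer (`k, l ≠ a`), read on the layer
variables. [folklore] -/
def hplaqG (e : LEdge d (n + 1) a → G) (y : LSite d (n + 1) a) (k l : Fin d) (hk : k ≠ a)
    (hl : l ≠ a) : G :=
  e ⟨(y, k), hk⟩ * e ⟨(LEdge.tgt ⟨(y, k), hk⟩, l), hl⟩ *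
    (e ⟨(LEdge.tgt ⟨(y, l), hl⟩, k), hk⟩)⁻¹ * (e ⟨(y, l), hl⟩)⁻¹

/-- **The in-layer cost**: the sum of `Re tr ρ` of the genuine horizontal plaquettes of a layer.
[folklore] -/
def layerCostG (a : Fin d) (e : LEdge d (n + 1) a → G) : ℝ :=
  ∑ y : LSite d (n + 1) a, ∑ k : Fin d, ∑ l : Fin d,
    if h : k < l ∧ k ≠ a ∧ l ≠ a then trRe ρ (hplaqG e y k l h.2.1 h.2.2) else 0

/-- **The slab chain of the representation `ρ`** on the torus `(ℤ/(n+1))^d` along the axis `a`.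
[folklore] -/
def gChain (ρ : G →* Matrix (Fin N) (Fin N) ℂ) (d n : ℕ) (a : Fin d) :
    SlabChain n (LEdge d (n + 1) a → G) (LSite d (n + 1) a → G) where
  a := fun _ => layerCostG ρ a
  s := fun _ => slabCostG ρ

/-- **THE PLAQUETTE SUM IS THE SLAB-CHAIN COST**: for a representation whose character satisfies
`Re tr ρ(g⁻¹) = Re tr ρ(g)`, the sum of `Re tr ρ` over all genuine plaquettes of the torus equals
the cost of the slab chain `gChain ρ` on the configuration read by heights. [folklore] -/
theorem sum_plaquetteTrRe_eq_cost (hρinv : ∀ g : G, trRe ρ g⁻¹ = trRe ρ g)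
    (W : GaugeConfig d (n + 1) G) :
    ∑ q ∈ torusGenuine d (n + 1), trRe ρ (plaquetteHolonomy W q.1 q.2.1 q.2.2) =
      (gChain ρ d n a).cost (heightCfgG a W) := by
  -- the left side as a triple sum with the three-way split
  have hL : ∑ q ∈ torusGenuine d (n + 1), trRe ρ (plaquetteHolonomy W q.1 q.2.1 q.2.2) =
      ∑ x : Site d (n + 1), ∑ k : Fin d, ∑ l : Fin d,
        if k < l then trRe ρ (plaquetteHolonomy W x k l) else 0 := by
    rw [torusGenuine, Finset.sum_filter]
    simp only [Fintype.sum_prod_type]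
  rw [hL]
  simp_rw [ite_lt_split a]
  simp only [Finset.sum_add_distrib]
  rw [add_assoc]
  -- the cost
  have hR : (gChain ρ d n a).cost (heightCfgG a W) =
      ∑ h : Fin (n + 1), layerCostG ρ a (layerCfgG a W h) +
        ∑ h : Fin (n + 1), slabCostG ρ (layerCfgG a W h) (vertCfgG a W h) (layerCfgG a W (h + 1)) :=
    rfl
  rw [hR]
  congr 1
  · -- horizontal plaquettes, by layer
    rw [← (siteEquivLayer (n := n) a).sum_comp, Fintype.sum_prod_type]
    refine sum_congr rfl fun h _ => ?_
    unfold layerCostG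
    refine sum_congr rfl fun y _ => sum_congr rfl fun k _ => sum_congr rfl fun l _ => ?_
    by_cases hkl : k < l ∧ k ≠ a ∧ l ≠ a
    · rw [if_pos hkl, dif_pos hkl]
      show trRe ρ (plaquetteHolonomy W (Function.update y.1 a (-(Lattice.U1Layer.toZ h))) k l) = _
      rw [plaquetteHolonomy_horizontalG W h y hkl.2.1 hkl.2.2, hplaqG]
    · rw [if_neg hkl, dif_neg hkl]
  · -- lateral plaquettes, by slab
    rw [← Finset.sum_add_distrib, ← (siteEquivSlab (n := n) a).sum_comp, Fintype.sum_prod_type]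
    refine sum_congr rfl fun h _ => ?_
    rw [slabCostG, sum_LEdge_eq_sum_dite]
    refine sum_congr rfl fun y _ => ?_
    show (∑ k, ∑ l, if k = a ∧ a < l then
        trRe ρ (plaquetteHolonomy W (Function.update y.1 a (-(Lattice.U1Layer.toZ h) - 1)) k l) else 0) +
        (∑ k, ∑ l, if l = a ∧ k < a then
          trRe ρ (plaquetteHolonomy W (Function.update y.1 a (-(Lattice.U1Layer.toZ h) - 1)) k l) else 0) = _
    -- collapse the direction forced to be the axis
    have hA : (∑ k : Fin d, ∑ l : Fin d, if k = a ∧ a < l then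
        trRe ρ (plaquetteHolonomy W (Function.update y.1 a (-(Lattice.U1Layer.toZ h) - 1)) k l) else 0) =
        ∑ l : Fin d, if a < l then
          trRe ρ (plaquetteHolonomy W (Function.update y.1 a (-(Lattice.U1Layer.toZ h) - 1)) a l) else 0 := by
      rw [Finset.sum_comm]
      refine sum_congr rfl fun l _ => ?_
      rw [Finset.sum_eq_single a (fun k _ hk => by simp [hk]) (fun h => absurd (mem_univ a) h)]
      simp
    have hB : (∑ k : Fin d, ∑ l : Fin d, if l = a ∧ k < a then
        trRe ρ (plaquetteHolonomy W (Function.update y.1 a (-(Lattice.U1Layer.toZ h) - 1)) k l) else 0) =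
        ∑ k : Fin d, if k < a then
          trRe ρ (plaquetteHolonomy W (Function.update y.1 a (-(Lattice.U1Layer.toZ h) - 1)) k a) else 0 := by
      refine sum_congr rfl fun k _ => ?_
      rw [Finset.sum_eq_single a (fun l _ hl => by simp [hl]) (fun h => absurd (mem_univ a) h)]
      simp
    rw [hA, hB, ← Finset.sum_add_distrib]
    refine sum_congr rfl fun b _ => ?_
    rcases lt_trichotomy a b with hab | rfl | hba
    · rw [if_pos hab, if_neg (not_lt.2 hab.le), dif_pos (ne_of_gt hab), add_zero,
        plaquetteHolonomy_lateralG W h y (ne_of_gt hab)]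
    · simp
    · rw [if_neg (not_lt.2 hba.le), if_pos hba, dif_pos (ne_of_lt hba), zero_add,
        plaquetteHolonomy_lateralG_rev W h y (ne_of_lt hba), hρinv]

/-! ## 4. The plaquette observables are layer plaquettes -/

/-- **The plaquette `(i, j)` based at `−t·e_a` is the layer plaquette of the layer at height `t`**:
its holonomy is `e(ℓ₀) e(ℓ₁) e(ℓ₂)⁻¹ e(ℓ₃)⁻¹` with `e = layerCfgG W t` and `ℓ_k = pedge k`. [folklore] -/
theorem plaquetteHolonomy_axisSite_eq {i j : Fin d} (hi : i ≠ a) (hj : j ≠ a)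
    (W : GaugeConfig d (n + 1) G) (τ : Fin (n + 1)) :
    plaquetteHolonomy W (Function.update (0 : Site d (n + 1)) a (-(Lattice.U1Layer.toZ τ))) i j =
      layerCfgG a W τ (pedge hi hj 0) * layerCfgG a W τ (pedge hi hj 1) *
        (layerCfgG a W τ (pedge hi hj 2))⁻¹ * (layerCfgG a W τ (pedge hi hj 3))⁻¹ := by
  have hh := plaquetteHolonomy_horizontalG W τ (zsite d (n + 1) a) hi hj
  rw [show ((zsite d (n + 1) a).1 : Site d (n + 1)) = 0 from rfl] at hh
  have ht0 : (pedge (L := n + 1) hi hj 0).tgt = usite hi := by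
    apply Subtype.ext; simp [LEdge.tgt, pedge, zsite, usite, Site.shift]
  have ht3 : (pedge (L := n + 1) hi hj 3).tgt = usite hj := by
    apply Subtype.ext; simp [LEdge.tgt, pedge, zsite, usite, Site.shift]
  rw [hh]
  simp only [show (0 : Fin 4) = ⟨0, by omega⟩ from rfl, show (1 : Fin 4) = ⟨1, by omega⟩ from rfl,
    show (2 : Fin 4) = ⟨2, by omega⟩ from rfl, show (3 : Fin 4) = ⟨3, by omega⟩ from rfl] at ht0 ht3 ⊢
  simp only [pedge] at ht0 ht3 ⊢
  rw [ht0, ht3]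

end Summit.Ventures.LatticeQCDFlow.Theory2.GroupLayer

end
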